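import Summits.AtomisticToContinuum.BoseEinsteinCondensation.Theorems.BECGroundStateSOSPeriodicIRBoundWFAssembly
import Summits.AtomisticToContinuum.BoseEinsteinCondensation.Theorems.BECInsertionCorrectorCorrectorClosureGroundStateFrame
import Summits.AtomisticToContinuum.BoseEinsteinCondensation.Theorems.BECInsertionCorrectorCorrectorClosureTiltCorrectorAux
import Summits.AtomisticToContinuum.BoseEinsteinCondensation.Theorems.CorrectorClosure.Negative.KacClosureHMinusOneSingleMode
import Literature.MathematicalPhysics.QuantumManyBody.WeightedCorrector
import Literature.MathematicalPhysics.QuantumManyBody.TorusFockLayer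
import HarnessLib

/-!
# Line `insertion-mode-gaussian-domination`, stub S1 `stub_holeKLS` — the one-sector Kennedy–Lieb–Shastry
# inequality in the HOLE channel with the CCR energy budget, real form
# (crux `BECInsertionCorrector.CorrectorClosure`, item stmt-AtomisticToContinuum-12058)

Supports (does not close) stmt-AtomisticToContinuum-12058. For a repulsive finite-range integrable `v` with bounded
periodisation on the torus of side `L`, the continuous positive Feynman–Kac ground states `Θ₀` (`N` bodies) and `Φ₀`
(`N + 1` bodies), a mode `n ≠ 0` and a real `b ≥ 0` dominating the removal susceptibility
`b₋(n) = ‖Re a(φ_n)Φ₀/Θ₀‖²₋₁ + ‖Im a(φ_n)Φ₀/Θ₀‖²₋₁ ≤ b` (Kipnis–Varadhan `H₋₁` norms for the weight `Θ₀`):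
`n_n² ≤ b · (p² + 2(N+1)‖v‖₁/L³ + μ_N n_n − μ_{N+1}(n_n + 1))`, `n_n = ‖a(φ_n)Φ₀‖²`, `μ_M = E₀(M+1) − E₀(M)`.

Chain (every analytic input is a landed lemma): `Φ = (Φ₀ : ℂ)` is a core attaining `E₀(N+1)`
(`stub_periodicGroundStateRegularity`, `periodicEnergy_le_of_isPeriodicGroundStateFK`); the Wagner–Feynman form
inequality `𝓔[aΦ] + 𝓔[a†Φ] ≤ (p² + 2(N+1)‖v‖₁/L³)‖Φ‖² + 𝓔[Φ] + 2 Re B(Φ, a†aΦ)` (`WF.wagnerFeynman_form_le`); the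
exact cross term `Re B(Φ, a†aΦ) = E₀(N+1) n_n` (`WF.abs_formRe_sub_le` at `δ = 0`, `WF.innerRe_numOp`); the `(N+2)`-body
variational principle `E₀(N+2)(1 + n_n) ≤ 𝓔[a†Φ]` (`WF.groundStateEnergy_mul_normSq_le`, `WF.normSq_modeCr`); the
ground-state representation w.r.t. `Θ₀` of both real quadratures of the hole state,
`𝓔[aΦ] − E₀(N)‖aΦ‖² = 𝓔_Θ₀(f,f) + 𝓔_Θ₀(g,g)`, `f = Re aΦ/Θ₀`, `g = Im aΦ/Θ₀` (`tilt_el_all` tested with `f²`, `g²`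
and the product rule `gradDot_mul_self_eq`); Kipnis–Varadhan's criterion `(∫ f²Θ₀²)² ≤ ‖f‖²₋₁ 𝓔_Θ₀(f,f)`
(`hMinusOneSqW_le_ofReal_iff`) per quadrature and `(x+y)² ≤ (b₁+b₂)(d₁+d₂)`. References (shape only):
T. Kennedy, E. H. Lieb, B. S. Shastry, J. Stat. Phys. 53 (1988) 1019, (12)–(14); C. Kipnis, S. R. S. Varadhan,
Comm. Math. Phys. 104 (1986) 1, (1.14).
-/

noncomputable section

open MeasureTheory
open scoped ENNReal NNReal ComplexConjugate BigOperators

namespace Summit.AtomisticToContinuum.BoseEinsteinCondensation.Theorems.CorrectorClosure.InsertionModeGaussianDomination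

open Literature.MathematicalPhysics.QuantumManyBody.BoseGas
open Summit.AtomisticToContinuum.BoseEinsteinCondensation.Cruxes.PeriodicIRBound.LinearPhFloorWagner.WF
open Summit.AtomisticToContinuum.BoseEinsteinCondensation.Theorems.CorrectorClosure.GeometricMeanCorrector
  (exists_trialState_of_fk realPos_of_ofReal tilt_el_all)
open Summit.AtomisticToContinuum.BoseEinsteinCondensation.Cruxes.HardCoreExtension.ThirdLawCurrentFloor
  (stub_periodicGroundStateRegularity)
open Summit.AtomisticToContinuum.BoseEinsteinCondensation.Theorems.TorusGroundState
  (periodicEnergy_le_of_isPeriodicGroundStateFK)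
open Summit.AtomisticToContinuum.BoseEinsteinCondensation.Cruxes.StaticResponseBound.UvThomsonForceWave
  (gradDot_mul_self_eq)

/-! ### Real-arithmetic and pointwise tools -/

/-- `(m + 1 : ℝ≥0∞) ≠ ⊤`. -/
private theorem natCast_add_one_ne_top (m : ℕ) : ((m : ℝ≥0∞) + 1) ≠ ⊤ :=
  ENNReal.add_ne_top.2 ⟨ENNReal.natCast_ne_top m, ENNReal.one_ne_top⟩

/-- Two-term Cauchy–Schwarz: `x² ≤ b₁d₁`, `y² ≤ b₂d₂` (all nonnegative) give `(x+y)² ≤ (b₁+b₂)(d₁+d₂)`.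
[folklore] -/
theorem sq_add_le_of_sq_le {x y b₁ b₂ d₁ d₂ : ℝ} (hx : 0 ≤ x) (hy : 0 ≤ y) (hb₁ : 0 ≤ b₁) (hb₂ : 0 ≤ b₂)
    (hd₁ : 0 ≤ d₁) (hd₂ : 0 ≤ d₂) (h₁ : x ^ 2 ≤ b₁ * d₁) (h₂ : y ^ 2 ≤ b₂ * d₂) :
    (x + y) ^ 2 ≤ (b₁ + b₂) * (d₁ + d₂) := by
  have hx' : x ≤ Real.sqrt (b₁ * d₁) := by
    rw [← Real.sqrt_sq hx]; exact Real.sqrt_le_sqrt h₁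
  have hy' : y ≤ Real.sqrt (b₂ * d₂) := by
    rw [← Real.sqrt_sq hy]; exact Real.sqrt_le_sqrt h₂
  have hxy : x * y ≤ Real.sqrt (b₁ * d₂) * Real.sqrt (b₂ * d₁) := by
    calc x * y ≤ Real.sqrt (b₁ * d₁) * Real.sqrt (b₂ * d₂) :=
          mul_le_mul hx' hy' hy (Real.sqrt_nonneg _)
      _ = Real.sqrt (b₁ * d₂) * Real.sqrt (b₂ * d₁) := by
          rw [← Real.sqrt_mul (mul_nonneg hb₁ hd₁), ← Real.sqrt_mul (mul_nonneg hb₁ hd₂)]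
          congr 1; ring
  have hamgm : 2 * (Real.sqrt (b₁ * d₂) * Real.sqrt (b₂ * d₁)) ≤ b₁ * d₂ + b₂ * d₁ := by
    nlinarith [sq_nonneg (Real.sqrt (b₁ * d₂) - Real.sqrt (b₂ * d₁)), Real.sq_sqrt (mul_nonneg hb₁ hd₂),
      Real.sq_sqrt (mul_nonneg hb₂ hd₁)]
  nlinarith [hxy, hamgm, h₁, h₂]

/-- **Real-arithmetic core of the hole-channel KLS step.** From the two per-quadrature Cauchy–Schwarz bounds, the
ground-state representation `qA − e₁ n_k = d_u + d_w`, the Wagner–Feynman form inequality, the exact cross term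
`B = e₂ n_k` and the `(N+2)`-body variational bound `e₃(n_k + 1) ≤ qC`, deduce the stub's real inequality. [folklore] -/
theorem real_core {nk nu nw bf bg b du dw qA qC e1 e2 e3 D B : ℝ}
    (hb : 0 ≤ b) (hbfg : bf + bg ≤ b) (hbf : 0 ≤ bf) (hbg : 0 ≤ bg) (hnu : 0 ≤ nu) (hnw : 0 ≤ nw)
    (hdu : 0 ≤ du) (hdw : 0 ≤ dw) (hnk : nk = nu + nw)
    (hCSu : nu ^ 2 ≤ bf * du) (hCSw : nw ^ 2 ≤ bg * dw)
    (hrep : qA - e1 * nk = du + dw)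
    (hWF : qA + qC ≤ D + e2 + 2 * B) (hB : B = e2 * nk) (hC : e3 * (nk + 1) ≤ qC) :
    nk ^ 2 ≤ b * (D + (e2 - e1) * nk - (e3 - e2) * (nk + 1)) := by
  have hcs : (nu + nw) ^ 2 ≤ (bf + bg) * (du + dw) := sq_add_le_of_sq_le hnu hnw hbf hbg hdu hdw hCSu hCSw
  have h1 : (bf + bg) * (du + dw) ≤ b * (du + dw) := mul_le_mul_of_nonneg_right hbfg (add_nonneg hdu hdw)
  have h2 : du + dw ≤ D + (e2 - e1) * nk - (e3 - e2) * (nk + 1) := by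
    rw [← hrep]
    linarith
  have h3 : b * (du + dw) ≤ b * (D + (e2 - e1) * nk - (e3 - e2) * (nk + 1)) := mul_le_mul_of_nonneg_left h2 hb
  calc nk ^ 2 = (nu + nw) ^ 2 := by rw [hnk]
    _ ≤ (bf + bg) * (du + dw) := hcs
    _ ≤ b * (du + dw) := h1
    _ ≤ _ := h3

/-- The real kinetic density of a complex function splits into the carrés du champ of its real and imaginary parts:
`|∇ψ|² = Γ(Re ψ, Re ψ) + Γ(Im ψ, Im ψ)`. [folklore] -/
theorem kineticDensityReal_eq_gradDot_add {M : ℕ} {ψ : Config M → ℂ} (hψ : Differentiable ℝ ψ) (X : Config M) :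
    kineticDensityReal ψ X =
      gradDot (fun Y => (ψ Y).re) (fun Y => (ψ Y).re) X + gradDot (fun Y => (ψ Y).im) (fun Y => (ψ Y).im) X := by
  have hre : fderiv ℝ (fun Y => (ψ Y).re) X = Complex.reCLM.comp (fderiv ℝ ψ X) :=
    (Complex.reCLM.hasFDerivAt.comp X (hψ X).hasFDerivAt).fderiv
  have him : fderiv ℝ (fun Y => (ψ Y).im) X = Complex.imCLM.comp (fderiv ℝ ψ X) :=
    (Complex.imCLM.hasFDerivAt.comp X (hψ X).hasFDerivAt).fderiv
  simp only [kineticDensityReal, gradDot, pderiv, hre, him, ContinuousLinearMap.coe_comp, Function.comp_apply,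
    Complex.reCLM_apply, Complex.imCLM_apply, ← Finset.sum_add_distrib]
  refine Finset.sum_congr rfl fun i _ => Finset.sum_congr rfl fun k _ => ?_
  rw [Complex.sq_norm, Complex.normSq_apply]

/-! ### The ground-state representation of one real quadrature -/

/-- **Ground-state representation for the weight `Θ₀` (Davies' ground-state transform, `C¹` form, unnormalised).**
For a measurable profile `w`, a positive `C¹` function `Θ₀` whose complexification is a periodic trial state `Θ`
attaining the ground-state energy `E₀(M, L) < ∞`, and a real `C¹` lattice-periodic `u`:
`∫|∇u|² + ∫ V u² = E₀(M,L) ∫ u² + 𝓔_Θ₀(u/Θ₀, u/Θ₀)` (the weak Euler–Lagrange equation `tilt_el_all` tested with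
`(u/Θ₀)²` and the product rule `|∇(θΘ₀)|² = ∇Θ₀·∇(θ²Θ₀) + |∇θ|²Θ₀²`).
[cite: Davies1989, §4.2 Thm 4.2.1 (proof), pp. 109–110] -/
theorem tilt_identity {M : ℕ} {L : ℝ} {w : ℝ → ℝ≥0∞} (hw : Measurable w) {Θ₀ : Config M → ℝ}
    (Θ : PeriodicTrialState M L) (hΘψ : Θ.ψ = fun X => ((Θ₀ X : ℝ) : ℂ)) (hpos : ∀ X, 0 < Θ₀ X)
    (hΘC1 : ContDiff ℝ 1 Θ₀) (hΘper : IsLatticePeriodic L Θ₀)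
    (hE : periodicEnergy w Θ = periodicGroundStateEnergy w M L) (hfin : periodicEnergy w Θ ≠ ⊤)
    {u : Config M → ℝ} (hu : ContDiff ℝ 1 u) (huper : IsLatticePeriodic L u) :
    (∫ X in cellN M L, gradDot u u X) + (∫ X in cellN M L, (periodicInteraction w L X).toReal * u X ^ 2) =
      (periodicEnergy w Θ).toReal * (∫ X in cellN M L, u X ^ 2) +
        dirichletFormW L Θ₀ (fun Y => u Y / Θ₀ Y) (fun Y => u Y / Θ₀ Y) := by
  have hne : ∀ X, Θ₀ X ≠ 0 := fun X => (hpos X).ne'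
  set θ : Config M → ℝ := fun Y => u Y / Θ₀ Y with hθdef
  have hθ : ContDiff ℝ 1 θ := hu.div hΘC1 hne
  have hθu : ∀ Y, θ Y * Θ₀ Y = u Y := fun Y => div_mul_cancel₀ (u Y) (hne Y)
  -- `Θ` is real positive with modulus `Θ₀`
  have hreal : ∀ X, Θ.ψ X = (‖Θ.ψ X‖ : ℂ) := fun X => (realPos_of_ofReal hpos Θ hΘψ X).1
  have hF : ∀ Y, ‖Θ.ψ Y‖ = Θ₀ Y := fun Y => by
    rw [hΘψ]; exact (Complex.norm_real _).trans (Real.norm_of_nonneg (hpos Y).le)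
  -- the weak Euler–Lagrange equation tested with `ζ = θ²`
  have hζ : ContDiff ℝ 1 fun Y => θ Y ^ 2 := hθ.pow 2
  have hζper : IsLatticePeriodic L fun Y => θ Y ^ 2 := fun X i k => by
    show (u _ / Θ₀ _) ^ 2 = (u X / Θ₀ X) ^ 2
    rw [huper X i k, hΘper X i k]
  have hEL := tilt_el_all hw hreal hE hfin hζ hζper
  simp only [hF] at hEL
  -- the product rule, integrated
  have hprod : ∀ X, gradDot u u X = gradDot Θ₀ (fun Y => θ Y ^ 2 * Θ₀ Y) X + gradDot θ θ X * Θ₀ X ^ 2 := by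
    intro X
    have h := gradDot_mul_self_eq (hθ.differentiable one_ne_zero X) (hΘC1.differentiable one_ne_zero X)
    have hfun : (fun Y => θ Y * Θ₀ Y) = u := funext hθu
    rw [hfun] at h
    exact h
  have hkin : ∫ X in cellN M L, gradDot u u X =
      (∫ X in cellN M L, gradDot Θ₀ (fun Y => θ Y ^ 2 * Θ₀ Y) X) + dirichletFormW L Θ₀ θ θ := by
    unfold dirichletFormW
    rw [← integral_add (integrableOn_cellN (continuous_gradDot hΘC1 (hζ.mul hΘC1)) L)
      (integrableOn_gradDot_mul_sq hΘC1.continuous hθ hθ L)]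
    exact integral_congr_ae (ae_of_all _ hprod)
  have hsq : ∀ X, θ X ^ 2 * Θ₀ X ^ 2 = u X ^ 2 := fun X => by rw [← hθu X]; ring
  have hpot : ∫ X in cellN M L, (periodicInteraction w L X).toReal * θ X ^ 2 * Θ₀ X ^ 2 =
      ∫ X in cellN M L, (periodicInteraction w L X).toReal * u X ^ 2 := by
    refine integral_congr_ae (ae_of_all _ fun X => ?_)
    show (periodicInteraction w L X).toReal * θ X ^ 2 * Θ₀ X ^ 2 = (periodicInteraction w L X).toReal * u X ^ 2
    rw [mul_assoc, hsq X]
  have hmass : ∫ X in cellN M L, θ X ^ 2 * Θ₀ X ^ 2 = ∫ X in cellN M L, u X ^ 2 :=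
    integral_congr_ae (ae_of_all _ hsq)
  rw [hpot, hmass] at hEL
  rw [hkin]
  linarith

/-! ### The stub -/

-- The registered signature carries `hΘc`, `hΦc`, `hΦp` (continuity is re-derived from `C¹` regularity and the
-- positivity of `Φ₀` is not needed), so the unused-variables linter is silenced for this one declaration.
set_option linter.unusedVariables false in
/-- **S1 `stub_holeKLS` — one-sector Kennedy–Lieb–Shastry inequality in the HOLE channel with the CCR energy
budget, real form.** For a repulsive finite-range integrable `v` with `v^per` bounded on the torus of side `L`, the
continuous positive FK ground states `Θ₀` (`N ≥ 1` bodies), `Φ₀` (`N+1` bodies), every `n ≠ 0` and every real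
`b ≥ 0` dominating the removal susceptibility `‖Re a(φ_n)Φ₀/Θ₀‖²₋₁ + ‖Im a(φ_n)Φ₀/Θ₀‖²₋₁ ≤ b`:
`n_n² ≤ b · (|2πn/L|² + 2(N+1)‖v‖₁/L³ + (E₀(N+1) − E₀(N)) n_n − (E₀(N+2) − E₀(N+1))(n_n + 1))`,
`n_n = cellOccupation (N+1) L φ_n Φ₀ = ‖a(φ_n)Φ₀‖²`. The hypotheses `hΘc`, `hΦc`, `hΦp` are part of the registered
signature (continuity follows from the `C¹` regularity used inside; positivity of `Φ₀` is not needed).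
[cite: KLS1988JSP, (12)–(14)] -/
theorem stub_holeKLS (v : ℝ → ℝ≥0∞) (hv : IsRepulsiveFiniteRange v) (hint : (∫⁻ x : Space, v ‖x‖) ≠ ⊤)
    (N : ℕ) (hN : 1 ≤ N) (L : ℝ) (hL : 0 < L) (hb : ∃ C : ℝ≥0, ∀ x, periodizedPotential v L x ≤ C)
    (Θ₀ : Config N → ℝ) (hΘ : IsPeriodicGroundStateFK v L Θ₀) (hΘc : Continuous Θ₀) (hΘp : ∀ X, 0 < Θ₀ X)
    (Φ₀ : Config (N + 1) → ℝ) (hΦ : IsPeriodicGroundStateFK v L Φ₀) (hΦc : Continuous Φ₀)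
    (hΦp : ∀ X, 0 < Φ₀ X) (n : Fin 3 → ℤ) (hn : n ≠ 0) (b : ℝ) (hb0 : 0 ≤ b)
    (hdom : hMinusOneSqW L Θ₀ (fun Y => (modeAn L (planeWaveMode L n) (fun X => (Φ₀ X : ℂ)) Y).re / Θ₀ Y) +
        hMinusOneSqW L Θ₀ (fun Y => (modeAn L (planeWaveMode L n) (fun X => (Φ₀ X : ℂ)) Y).im / Θ₀ Y) ≤
      ENNReal.ofReal b) :
    (cellOccupation (N + 1) L (planeWaveMode L n) (fun X => (Φ₀ X : ℂ))).toReal ^ 2 ≤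
      b * (‖latticeVec (2 * Real.pi / L) n‖ ^ 2 + 2 * ((N : ℝ) + 1) * (∫⁻ x : Space, v ‖x‖).toReal / L ^ 3
        + ((periodicGroundStateEnergy v (N + 1) L).toReal - (periodicGroundStateEnergy v N L).toReal) *
            (cellOccupation (N + 1) L (planeWaveMode L n) (fun X => (Φ₀ X : ℂ))).toReal
        - ((periodicGroundStateEnergy v (N + 2) L).toReal - (periodicGroundStateEnergy v (N + 1) L).toReal) *
            ((cellOccupation (N + 1) L (planeWaveMode L n) (fun X => (Φ₀ X : ℂ))).toReal + 1)) := by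
  obtain ⟨m, rfl⟩ : ∃ m, N = m + 1 := ⟨N - 1, by omega⟩
  have hw : Measurable v := hv.1
  obtain ⟨C, hC⟩ := hb
  -- `C¹` regularity of the two Feynman–Kac ground states
  have hΘC1 : ContDiff ℝ 1 Θ₀ := stub_periodicGroundStateRegularity (m + 1) L v hN hL hw ⟨C, hC⟩ Θ₀ hΘ
  have hΦC1 : ContDiff ℝ 1 Φ₀ :=
    stub_periodicGroundStateRegularity (m + 1 + 1) L v (Nat.le_add_left 1 _) hL hw ⟨C, hC⟩ Φ₀ hΦ
  -- the trial states and their energies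
  obtain ⟨ΘT, hΘT⟩ := exists_trialState_of_fk hΘ hΘC1
  obtain ⟨ΦT, hΦT⟩ := exists_trialState_of_fk hΦ hΦC1
  have hEΘ : periodicEnergy v ΘT = periodicGroundStateEnergy v (m + 1) L :=
    le_antisymm (periodicEnergy_le_of_isPeriodicGroundStateFK hL hw hC hΘ hΘC1 ΘT hΘT)
      (periodicGroundStateEnergy_le v ΘT)
  have hEΦ : periodicEnergy v ΦT = periodicGroundStateEnergy v (m + 1 + 1) L :=
    le_antisymm (periodicEnergy_le_of_isPeriodicGroundStateFK hL hw hC hΦ hΦC1 ΦT hΦT)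
      (periodicGroundStateEnergy_le v ΦT)
  have hE1top : periodicGroundStateEnergy v (m + 1) L ≠ ⊤ := hΘ.energy_ne_top
  have hE2top : periodicGroundStateEnergy v (m + 1 + 1) L ≠ ⊤ := hΦ.energy_ne_top
  have hΘfin : periodicEnergy v ΘT ≠ ⊤ := by rw [hEΘ]; exact hE1top
  -- the core `Φ`
  set Φ : Config (m + 1 + 1) → ℂ := fun X => (Φ₀ X : ℂ) with hΦdef
  have hΦcore : IsCore L Φ :=
    ⟨Complex.ofRealCLM.contDiff.comp hΦC1,
      fun X i k => by simp only [hΦdef, hΦ.periodic X i k],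
      fun σ X => by simp only [hΦdef, hΦ.symm σ X]⟩
  have hΦE : qform v L Φ = periodicGroundStateEnergy v (m + 1 + 1) L := by
    rw [← hEΦ, periodicEnergy_eq_qform, hΦT]
  have hΦ1 : normSq L Φ = 1 := by
    have h := ΦT.norm_eq
    rw [hΦT] at h
    exact h
  have hΦEtop : qform v L Φ ≠ ⊤ := by rw [hΦE]; exact hE2top
  -- the hole state `a = a(φ_n)Φ`, the particle state `c = a†(φ_n)Φ`, and `a†aΦ`
  set aΦ : Config (m + 1) → ℂ := modeAn L (planeWaveMode L n) Φ with haΦ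
  set cΦ : Config (m + 1 + 1 + 1) → ℂ := modeCr (planeWaveMode L n) Φ with hcΦ
  set NΦ : Config (m + 1 + 1) → ℂ := modeCr (planeWaveMode L n) aΦ with hNΦ
  have haΦc : IsCore L aΦ := isCore_modeAn hL n hΦcore
  have hcΦc : IsCore L cΦ := isCore_modeCr hL n hΦcore
  have hNΦc : IsCore L NΦ := isCore_modeCr hL n haΦc
  have haC1 : ContDiff ℝ 1 aΦ := haΦc.contDiff
  have haCont : Continuous aΦ := haC1.continuous
  -- occupation `n_k = ‖aΦ‖²` and `‖a†Φ‖² = 1 + n_k`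
  set νE : ℝ≥0∞ := cellOccupation (m + 1 + 1) L (planeWaveMode L n) Φ with hνE
  have hnAE : normSq L aΦ = νE := normSq_modeAn hL n Φ
  have hnCE : normSq L cΦ = 1 + νE := by rw [hcΦ, normSq_modeCr hL n hΦcore, hΦ1]
  have hνle : νE ≤ ((m + 1 + 1 : ℕ) : ℝ≥0∞) * normSq L Φ :=
    cellOccupation_le_mul_normSq hL n hΦcore.contDiff.continuous
  rw [hΦ1, mul_one] at hνle
  have hνtop : νE ≠ ⊤ := ne_top_of_le_ne_top (ENNReal.natCast_ne_top _) hνle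
  set nk : ℝ := νE.toReal with hnk
  have hnAtop : normSq L aΦ ≠ ⊤ := by rw [hnAE]; exact hνtop
  have hnAr : (normSq L aΦ).toReal = nk := by rw [hnAE]
  have hnCr : (normSq L cΦ).toReal = nk + 1 := by
    rw [hnCE, ENNReal.toReal_add ENNReal.one_ne_top hνtop, ENNReal.toReal_one]; ring
  -- a priori finiteness of the three energies
  have haΦE := qform_modeAn_le hL hw n hΦcore
  have haΦEtop : qform v L aΦ ≠ ⊤ :=
    ne_top_of_le_ne_top (ENNReal.mul_ne_top (natCast_add_one_ne_top _) hΦEtop) haΦE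
  have hcΦE := qform_modeCr_le hL hw hint n hΦcore
  have hcΦEtop : qform v L cΦ ≠ ⊤ :=
    ne_top_of_le_ne_top (ENNReal.mul_ne_top (natCast_add_one_ne_top _) (ENNReal.add_ne_top.2
      ⟨hΦEtop, ENNReal.mul_ne_top ENNReal.ofReal_ne_top (by rw [hΦ1]; exact ENNReal.one_ne_top)⟩)) hcΦE
  have hNΦE := qform_modeCr_le hL hw hint n haΦc
  have hNΦEtop : qform v L NΦ ≠ ⊤ :=
    ne_top_of_le_ne_top (ENNReal.mul_ne_top (natCast_add_one_ne_top _) (ENNReal.add_ne_top.2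
      ⟨haΦEtop, ENNReal.mul_ne_top ENNReal.ofReal_ne_top hnAtop⟩)) hNΦE
  set qA : ℝ := (qform v L aΦ).toReal with hqA
  set qC : ℝ := (qform v L cΦ).toReal with hqC
  -- the three ground-state energies, `‖v‖₁` and `p` in reals
  set e1 : ℝ := (periodicGroundStateEnergy v (m + 1) L).toReal with he1
  set e2 : ℝ := (periodicGroundStateEnergy v (m + 1 + 1) L).toReal with he2
  set e3 : ℝ := (periodicGroundStateEnergy v (m + 1 + 2) L).toReal with he3
  set V₁ : ℝ := (∫⁻ x : Space, v ‖x‖).toReal with hV₁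
  set pv : Space := latticeVec (2 * Real.pi / L) n with hpv
  -- (1) the Wagner–Feynman form inequality at `Φ` (`‖Φ‖² = 1`, `𝓔[Φ] = E₀(N+1)`)
  set B : ℝ := formRe v L Φ NΦ with hB
  have hWF : qA + qC ≤ (‖pv‖ ^ 2 + 2 * ((m : ℝ) + 2) * V₁ / L ^ 3) + e2 + 2 * B := by
    have h := wagnerFeynman_form_le hL hw hint hn hΦcore hΦEtop
    rw [hΦ1, ENNReal.toReal_one, mul_one, hΦE] at h
    exact h
  -- (2) the exact cross term `Re B(Φ, a†aΦ) = E₀(N+1) n_k` (polar bound at `δ = 0`)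
  have hBeq : B = e2 * nk := by
    have hnear : (qform v L Φ).toReal ≤
        (periodicGroundStateEnergy v (m + 1 + 1) L).toReal * (normSq L Φ).toReal + 0 := by
      rw [hΦ1, ENNReal.toReal_one, mul_one, add_zero, hΦE]
    have h := abs_formRe_sub_le hL hw hΦcore hNΦc hΦEtop hNΦEtop hE2top le_rfl hnear
    have hi : innerRe L Φ NΦ = nk := innerRe_numOp hL n hΦcore
    rw [Real.sqrt_zero, zero_mul, hi] at h
    exact sub_eq_zero.1 (abs_nonpos_iff.1 h)
  -- (3) the `(N+2)`-body variational principle at `a†Φ`: `E₀(N+2)(n_k + 1) ≤ 𝓔[a†Φ]`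
  have hchanC : e3 * (nk + 1) ≤ qC := by
    have hA1 : periodicGroundStateEnergy v (m + 1 + 2) L * normSq L cΦ ≤ qform v L cΦ :=
      groundStateEnergy_mul_normSq_le hL hw hcΦc
    have h := ENNReal.toReal_mono hcΦEtop hA1
    rw [ENNReal.toReal_mul, hnCr] at h
    exact h
  -- (4) the two real quadratures `Re aΦ`, `Im aΦ` and their ground-state representation w.r.t. `Θ₀`
  have huC1 : ContDiff ℝ 1 fun Y => (aΦ Y).re := Complex.reCLM.contDiff.comp haC1
  have hwC1 : ContDiff ℝ 1 fun Y => (aΦ Y).im := Complex.imCLM.contDiff.comp haC1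
  have huper : IsLatticePeriodic L fun Y => (aΦ Y).re := fun X i k => by
    show (aΦ (X + _)).re = (aΦ X).re
    rw [haΦc.periodic X i k]
  have hwper : IsLatticePeriodic L fun Y => (aΦ Y).im := fun X i k => by
    show (aΦ (X + _)).im = (aΦ X).im
    rw [haΦc.periodic X i k]
  have hΘper : IsLatticePeriodic L Θ₀ := hΘ.periodic
  have hΘ0 : ∀ Y, Θ₀ Y ≠ 0 := fun Y => (hΘp Y).ne'
  have e1eq : (periodicEnergy v ΘT).toReal = e1 := by rw [hEΘ]
  have hrepU := tilt_identity hw ΘT hΘT hΘp hΘC1 hΘper hEΘ hΘfin huC1 huper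
  have hrepW := tilt_identity hw ΘT hΘT hΘp hΘC1 hΘper hEΘ hΘfin hwC1 hwper
  rw [e1eq] at hrepU hrepW
  -- `𝓔[aΦ] = (∫|∇Re aΦ|² + ∫|∇Im aΦ|²) + (∫V (Re aΦ)² + ∫V (Im aΦ)²)` and `n_k = ∫(Re aΦ)² + ∫(Im aΦ)²`
  have hPa : potForm v L aΦ ≠ ⊤ := ne_top_of_le_ne_top haΦEtop (potForm_le_qform' v L aΦ)
  have hsqz : ∀ z : ℂ, ‖z‖ ^ 2 = z.re ^ 2 + z.im ^ 2 := fun z => by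
    rw [Complex.sq_norm, Complex.normSq_apply]; ring
  have hVint := integrable_potReal hw haCont hPa
  have hVdom : ∀ p : ℂ → ℝ, (∀ z, p z ^ 2 ≤ ‖z‖ ^ 2) → Continuous p →
      Integrable (fun X => (periodicInteraction v L X).toReal * p (aΦ X) ^ 2)
        (volume.restrict (cellN (m + 1) L)) := by
    intro p hp hpc
    refine hVint.mono' ?_ (ae_of_all _ fun X => ?_)
    · exact ((measurable_periodicInteraction_wf hw L).ennreal_toReal.mul
        ((hpc.measurable.comp haCont.measurable).pow_const _)).aestronglyMeasurable
    · rw [Real.norm_eq_abs, abs_of_nonneg (mul_nonneg ENNReal.toReal_nonneg (sq_nonneg _))]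
      exact mul_le_mul_of_nonneg_left (hp _) ENNReal.toReal_nonneg
  have hVre := hVdom Complex.re (fun z => by rw [hsqz]; nlinarith [sq_nonneg z.im]) Complex.continuous_re
  have hVim := hVdom Complex.im (fun z => by rw [hsqz]; nlinarith [sq_nonneg z.re]) Complex.continuous_im
  have hqAsplit : qA = ((∫ X in cellN (m + 1) L, gradDot (fun Y => (aΦ Y).re) (fun Y => (aΦ Y).re) X) +
        ∫ X in cellN (m + 1) L, gradDot (fun Y => (aΦ Y).im) (fun Y => (aΦ Y).im) X) +
      ((∫ X in cellN (m + 1) L, (periodicInteraction v L X).toReal * (aΦ X).re ^ 2) +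
        ∫ X in cellN (m + 1) L, (periodicInteraction v L X).toReal * (aΦ X).im ^ 2) := by
    rw [hqA, toReal_qform v L haC1 hPa]
    congr 1
    · unfold cellKineticEnergy
      rw [← integral_add (integrableOn_cellN (continuous_gradDot huC1 huC1) L)
        (integrableOn_cellN (continuous_gradDot hwC1 hwC1) L)]
      exact integral_congr_ae (ae_of_all _ fun X =>
        kineticDensityReal_eq_gradDot_add (haC1.differentiable one_ne_zero) X)
    · rw [← integral_potReal hw haCont hPa, ← integral_add hVre hVim]
      refine integral_congr_ae (ae_of_all _ fun X => ?_)
      show (periodicInteraction v L X).toReal * ‖aΦ X‖ ^ 2 =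
        (periodicInteraction v L X).toReal * (aΦ X).re ^ 2 + (periodicInteraction v L X).toReal * (aΦ X).im ^ 2
      rw [hsqz]; ring
  have hcu2 : Continuous fun X => (aΦ X).re ^ 2 := (Complex.continuous_re.comp haCont).pow 2
  have hcw2 : Continuous fun X => (aΦ X).im ^ 2 := (Complex.continuous_im.comp haCont).pow 2
  have hnksplit : nk = (∫ X in cellN (m + 1) L, (aΦ X).re ^ 2) + ∫ X in cellN (m + 1) L, (aΦ X).im ^ 2 := by
    rw [← hnAr, toReal_normSq haCont, ← integral_add (integrableOn_cellN hcu2 L) (integrableOn_cellN hcw2 L)]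
    exact integral_congr_ae (ae_of_all _ fun X => hsqz (aΦ X))
  -- (5) Kipnis–Varadhan's criterion per quadrature: `(∫ f²Θ₀²)² ≤ ‖f‖²₋₁ 𝓔_Θ₀(f,f)`
  set f : Config (m + 1) → ℝ := fun Y => (aΦ Y).re / Θ₀ Y with hf
  set g : Config (m + 1) → ℝ := fun Y => (aΦ Y).im / Θ₀ Y with hg
  have hfTop : hMinusOneSqW L Θ₀ f ≠ ⊤ := ne_top_of_le_ne_top ENNReal.ofReal_ne_top (le_self_add.trans hdom)
  have hgTop : hMinusOneSqW L Θ₀ g ≠ ⊤ := ne_top_of_le_ne_top ENNReal.ofReal_ne_top (le_add_self.trans hdom)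
  have hbfg : (hMinusOneSqW L Θ₀ f).toReal + (hMinusOneSqW L Θ₀ g).toReal ≤ b := by
    have h := ENNReal.toReal_mono ENNReal.ofReal_ne_top hdom
    rwa [ENNReal.toReal_add hfTop hgTop, ENNReal.toReal_ofReal hb0] at h
  have hftest : IsPeriodicTest L f := ⟨huC1.div hΘC1 hΘ0, fun X i k => by
    show (aΦ (X + _)).re / Θ₀ (X + _) = (aΦ X).re / Θ₀ X
    rw [haΦc.periodic X i k, hΘper X i k]⟩
  have hgtest : IsPeriodicTest L g := ⟨hwC1.div hΘC1 hΘ0, fun X i k => by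
    show (aΦ (X + _)).im / Θ₀ (X + _) = (aΦ X).im / Θ₀ X
    rw [haΦc.periodic X i k, hΘper X i k]⟩
  have hCSf := (hMinusOneSqW_le_ofReal_iff (ENNReal.toReal_nonneg (a := hMinusOneSqW L Θ₀ f))).1
    (ENNReal.ofReal_toReal hfTop).ge f hftest
  have hCSg := (hMinusOneSqW_le_ofReal_iff (ENNReal.toReal_nonneg (a := hMinusOneSqW L Θ₀ g))).1
    (ENNReal.ofReal_toReal hgTop).ge g hgtest
  have hdivsq : ∀ (x t : ℝ), t ≠ 0 → x / t * (x / t) * t ^ 2 = x ^ 2 := fun x t ht => by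
    calc x / t * (x / t) * t ^ 2 = (x / t * t) * (x / t * t) := by ring
      _ = x ^ 2 := by rw [div_mul_cancel₀ x ht]; ring
  have hff : ∫ X in cellN (m + 1) L, f X * f X * Θ₀ X ^ 2 = ∫ X in cellN (m + 1) L, (aΦ X).re ^ 2 :=
    integral_congr_ae (ae_of_all _ fun X => hdivsq (aΦ X).re (Θ₀ X) (hΘ0 X))
  have hgg : ∫ X in cellN (m + 1) L, g X * g X * Θ₀ X ^ 2 = ∫ X in cellN (m + 1) L, (aΦ X).im ^ 2 :=
    integral_congr_ae (ae_of_all _ fun X => hdivsq (aΦ X).im (Θ₀ X) (hΘ0 X))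
  rw [hff] at hCSf
  rw [hgg] at hCSg
  -- (6) assemble
  have hnu : 0 ≤ ∫ X in cellN (m + 1) L, (aΦ X).re ^ 2 := integral_nonneg fun X => sq_nonneg _
  have hnw : 0 ≤ ∫ X in cellN (m + 1) L, (aΦ X).im ^ 2 := integral_nonneg fun X => sq_nonneg _
  have hrep : qA - e1 * nk = dirichletFormW L Θ₀ f f + dirichletFormW L Θ₀ g g := by
    rw [hqAsplit, hnksplit]; linarith [hrepU, hrepW]
  have key := real_core hb0 hbfg ENNReal.toReal_nonneg ENNReal.toReal_nonneg hnu hnw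
    (dirichletFormW_self_nonneg L Θ₀ f) (dirichletFormW_self_nonneg L Θ₀ g) hnksplit hCSf hCSg hrep hWF hBeq
    hchanC
  calc nk ^ 2 ≤ _ := key
    _ = _ := by push_cast; ring

end Summit.AtomisticToContinuum.BoseEinsteinCondensation.Theorems.CorrectorClosure.InsertionModeGaussianDomination

end
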